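import Literature.RingTheory.MvPowerSeries.MaximalIdealPow
import HarnessLib

/-!
# Ideals of finite colength in `K⟦x₁,…,xₙ⟧` contain a power of every variable and of `𝔪`

`Literature/RingTheory/MvPowerSeries/FiniteColength.lean`, grouping namespace
`Literature.RingTheory.MvPowerSeries.Jets` (continuing `MaximalIdealPow.lean`). For a field `K` and
an ideal `I` of `R = MvPowerSeries σ K` with `R ⧸ I` FINITE-DIMENSIONAL over `K`:

* `exists_forall_X_pow_mem_of_finite_quotient` — one power `N` with `X i ^ N ∈ I` for every variable
  (the class of `X i` is integral over `K`; factor its monic relation `q = X^N · q'` with `q'(0) ≠ 0`, so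
  that `q'(X i)` is a unit of `R`);
* `exists_maximalIdeal_pow_le_of_finite_quotient` — `𝔪 ^ M ≤ I` for some `M` (finitely many
  variables), i.e. `I` is `𝔪`-primary with an explicit exponent;
* `exists_coe_sub_mem_of_finite_quotient` — every series is congruent to a POLYNOMIAL modulo `I`
  (jets), so the polynomial subalgebra — indeed any subalgebra containing the variables — surjects
  onto `R ⧸ I` (`mkₐ_comp_surjective_of_finite_quotient`).

Standard facts ("an Artinian local quotient of `K⟦x⟧` has nilpotent maximal ideal"), e.g.
Greuel–Lossen–Shustin, *Introduction to Singularities and Deformations* (2007), §I.1.2–I.1.3.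
Everything is PROVED; no definitions.

## References
* [GreuelLossenShustin2007] G.-M. Greuel, C. Lossen, E. Shustin, Introduction to Singularities and
  Deformations, Springer 2007, §I.1.
-/

noncomputable section

open MvPowerSeries Finsupp IsLocalRing Polynomial

namespace Literature.RingTheory.MvPowerSeries.Jets

variable {σ : Type*} {K : Type*} [Field K]

/-- **A finite-colength ideal contains a (uniform) power of every variable.** If `K⟦x₁,…,xₙ⟧ ⧸ I`
is finite over `K` then for some `N`, `X i ^ N ∈ I` for all `i` (the class of each `X i` is integral
over `K`; factor its monic relation `q = X^N · q'` with `q'(0) ≠ 0`, so that `q'(X i)` is a unit).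
[folklore] -/
theorem exists_forall_X_pow_mem_of_finite_quotient [Finite σ] (I : Ideal (MvPowerSeries σ K))
    [Module.Finite K (MvPowerSeries σ K ⧸ I)] :
    ∃ N : ℕ, ∀ i : σ, (X i : MvPowerSeries σ K) ^ N ∈ I := by
  classical
  haveI := Fintype.ofFinite σ
  have key : ∀ i : σ, ∃ N : ℕ, (X i : MvPowerSeries σ K) ^ N ∈ I := by
    intro i
    set x : MvPowerSeries σ K ⧸ I := Ideal.Quotient.mk I (X i) with hx
    have hint : IsIntegral K x := IsIntegral.of_finite K x
    obtain ⟨q, hmonic, hq⟩ := hint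
    have hq0 : q ≠ 0 := hmonic.ne_zero
    obtain ⟨q', hqeq, hndvd⟩ := Polynomial.exists_eq_pow_rootMultiplicity_mul_and_not_dvd q hq0 0
    set N := q.rootMultiplicity 0
    refine ⟨N, ?_⟩
    -- `q(X i) ∈ I`
    have hmem : Polynomial.aeval (X i : MvPowerSeries σ K) q ∈ I := by
      rw [← Ideal.Quotient.eq_zero_iff_mem, ← Ideal.Quotient.mkₐ_eq_mk K, ← Polynomial.aeval_algHom_apply,
        Ideal.Quotient.mkₐ_eq_mk, ← hx]
      rwa [Polynomial.aeval_def]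
    -- `q(X i) = X i ^ N * q'(X i)` with `q'(X i)` a unit
    have hfac : Polynomial.aeval (X i : MvPowerSeries σ K) q =
        (X i : MvPowerSeries σ K) ^ N * Polynomial.aeval (X i : MvPowerSeries σ K) q' := by
      conv_lhs => rw [hqeq]
      simp [map_mul, map_pow]
    have hunit : IsUnit (Polynomial.aeval (X i : MvPowerSeries σ K) q') := by
      rw [MvPowerSeries.isUnit_iff_constantCoeff]
      have h0 : constantCoeff (Polynomial.aeval (X i : MvPowerSeries σ K) q') = q'.eval 0 := by
        rw [Polynomial.aeval_def, Polynomial.hom_eval₂, constantCoeff_X, Polynomial.eval]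
        congr 1
      rw [h0]
      exact isUnit_iff_ne_zero.mpr fun hr => hndvd (Polynomial.dvd_iff_isRoot.mpr hr)
    obtain ⟨u, hu⟩ := hunit
    have : (X i : MvPowerSeries σ K) ^ N = Polynomial.aeval (X i : MvPowerSeries σ K) q * ↑u⁻¹ := by
      rw [hfac, ← hu, mul_assoc, Units.mul_inv, mul_one]
    rw [this]
    exact Ideal.mul_mem_right _ _ hmem
  choose N hN using key
  refine ⟨∑ i, N i, fun i => ?_⟩
  have hle : N i ≤ ∑ k, N k := Finset.single_le_sum (fun k _ => Nat.zero_le (N k)) (Finset.mem_univ i)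
  obtain ⟨d, hd⟩ := Nat.exists_eq_add_of_le hle
  rw [hd, pow_add]
  exact Ideal.mul_mem_right _ _ (hN i)

/-- **A finite-colength ideal is `𝔪`-primary with an explicit exponent**: if `K⟦x₁,…,xₙ⟧ ⧸ I` is
finite over `K` then `𝔪 ^ M ≤ I` for some `M`. [folklore] -/
theorem exists_maximalIdeal_pow_le_of_finite_quotient [Finite σ] (I : Ideal (MvPowerSeries σ K))
    [Module.Finite K (MvPowerSeries σ K ⧸ I)] :
    ∃ M : ℕ, maximalIdeal (MvPowerSeries σ K) ^ M ≤ I := by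
  classical
  haveI := Fintype.ofFinite σ
  obtain ⟨N₀, hN⟩ := exists_forall_X_pow_mem_of_finite_quotient I
  let N : σ → ℕ := fun _ => N₀
  refine ⟨∑ i, N i + 1, ?_⟩
  rw [maximalIdeal_pow_eq_span_monomial, Ideal.span_le]
  rintro _ ⟨e, he, rfl⟩
  -- some exponent `e i ≥ N i`, else `|e| ≤ Σ N i < Σ N i + 1 = |e|`
  have : ∃ i, N i ≤ e i := by
    by_contra hcon
    push Not at hcon
    have hle : ∑ i, e i ≤ ∑ i, N i := Finset.sum_le_sum fun i _ => (hcon i).le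
    rw [Set.mem_setOf_eq, Finsupp.degree_eq_sum] at he
    omega
  obtain ⟨i, hi⟩ := this
  -- `monomial e 1 = X i ^ N i * monomial (e - single i (N i)) 1`
  have hsplit : monomial e (1 : K) =
      (X i : MvPowerSeries σ K) ^ N i * monomial (e - single i (N i)) (1 : K) := by
    have hexp : single i (N i) + (e - single i (N i)) = e := by
      ext j
      rw [Finsupp.add_apply, Finsupp.tsub_apply, single_apply]
      split_ifs with hij
      · subst hij; omega
      · omega
    rw [X_pow_eq, MvPowerSeries.monomial_mul_monomial, one_mul, hexp]
  change monomial e (1 : K) ∈ I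
  rw [hsplit]
  exact Ideal.mul_mem_right _ _ (hN i)

/-- **Jets modulo a finite-colength ideal**: if `K⟦x₁,…,xₙ⟧ ⧸ I` is finite over `K`, every series is
congruent modulo `I` to a polynomial. [folklore] -/
theorem exists_coe_sub_mem_of_finite_quotient [Finite σ] (I : Ideal (MvPowerSeries σ K))
    [Module.Finite K (MvPowerSeries σ K ⧸ I)] (f : MvPowerSeries σ K) :
    ∃ P : MvPolynomial σ K, f - ↑P ∈ I := by
  classical
  haveI := Fintype.ofFinite σ
  obtain ⟨M, hM⟩ := exists_maximalIdeal_pow_le_of_finite_quotient I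
  exact ⟨truncTotal M f, hM (sub_coe_truncTotal_mem_maximalIdeal_pow M f)⟩

/-- **Any `K`-subalgebra of `K⟦x₁,…,xₙ⟧` containing the variables surjects onto a finite quotient**
`K⟦x⟧ ⧸ I`. [folklore] -/
theorem mk_comp_subtype_surjective_of_finite_quotient [Finite σ] (I : Ideal (MvPowerSeries σ K))
    [Module.Finite K (MvPowerSeries σ K ⧸ I)] (B : Subalgebra K (MvPowerSeries σ K))
    (hB : ∀ i, (X i : MvPowerSeries σ K) ∈ B) :
    Function.Surjective fun b : B => Ideal.Quotient.mk I (b : MvPowerSeries σ K) := by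
  classical
  intro y
  obtain ⟨f, rfl⟩ := Ideal.Quotient.mk_surjective y
  obtain ⟨P, hP⟩ := exists_coe_sub_mem_of_finite_quotient I f
  have hPB : (↑P : MvPowerSeries σ K) ∈ B := by
    clear hP
    induction P using MvPolynomial.induction_on with
    | C a =>
      rw [MvPolynomial.coe_C, MvPowerSeries.c_eq_algebraMap]
      exact B.algebraMap_mem a
    | add p q hp hq => rw [MvPolynomial.coe_add]; exact B.add_mem hp hq
    | mul_X p j hp => rw [MvPolynomial.coe_mul, MvPolynomial.coe_X]; exact B.mul_mem hp (hB j)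
  refine ⟨⟨↑P, hPB⟩, ?_⟩
  simp only
  rw [Ideal.Quotient.eq]
  have := I.neg_mem hP
  rwa [neg_sub] at this

end Literature.RingTheory.MvPowerSeries.Jets

end
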